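import Summits.HodgeConjecture.HodgeConjecture.Theses.NikulinTwinTransport

/-!
# Strategy census — DECOMPOSITION sketch for crux `TwinTwistorTransport` (stmt-HodgeConjecture-14393)

Planner `planner-cstrat-stmt-HodgeConjecture-14393-p1-0` (crux-strategist, wall-breaker), 2026-08-17.
The best TYPED split of the crux this seat could produce (STRATEGY-CENSUS.md §Decomposition, D1):
a locus split by the two structures under which the crux is known or reduces to an existing item —
(N) the Nikulin locus (a symplectic involution), (T) the norm-2 locus (a rational type-preserving
2-self-similitude of `H²(S)`; contains the CM-with-2-a-norm points and the RM-√2 locus, where the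
twin is Hodge-isometric to `S` and the crux is `RealMultiplicationSqrtTwoAlgebraic` by Buskin) — and
(G) the complement, which contains every K3 surface with `End_Hdg(T) = ℚ` and `ρ ≤ 8`, i.e. the very
general member of every family: (G) IS the crux's whole difficulty, which is why the split is recorded
in the census and NOT filed with `route edit --split`.  Everything here is kernel-checked bookkeeping:
`crux_iff` (the crux restated through `AnchorAt`, by `Iff.rfl`), `crux_of_subs` (the glue
N → T → G → crux) and `subs_of_crux` (each piece is a restriction of the crux).
-/

namespace Summit.HodgeConjecture.HodgeConjecture.Cruxes.TwinTwistorTransport.StrategyCensus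

open Literature.AlgebraicGeometry.HodgeTheory Literature.AlgebraicGeometry.Motives
open Literature.AlgebraicTopology.SingularHomology CategoryTheory
open scoped Manifold

/-- The K3 block, verbatim as unfolded in every item of the route (`IsK3Surface` body). -/
def K3Block (S : SchemeOver ℂ) : Prop :=
  (Literature.AlgebraicGeometry.Motives.IsSmoothProjective 2 S ∧ Subsingleton (Literature.AlgebraicGeometry.Motives.structureSheafCohomology S.left 1) ∧ ∃ (A : Literature.AlgebraicGeometry.HodgeTheory.HodgeModel 2 S) (η : Literature.Geometry.Kaehler.MForm 𝓘(ℝ, A.model) A.carrier ℂ 2), Literature.Geometry.Kaehler.IsHolomorphicInCharts η ∧ ∀ x, η x ≠ 0)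

/-- `p` is an integral generator of `H⁴(S(ℂ);ℂ)` (verbatim clause of the crux). -/
def IsGenerator (S : SchemeOver ℂ) (p : complexBetti S (2 * 2)) : Prop :=
  Literature.AlgebraicGeometry.HodgeTheory.IsIntegralClass p ∧ ∀ q : Literature.AlgebraicGeometry.HodgeTheory.complexBetti S (2 * 2), Literature.AlgebraicGeometry.HodgeTheory.IsIntegralClass q → ∃ n : ℤ, q = n • p

/-- The crux's conclusion at one `(μ, S, hS, p)`: the ANCHOR — a projective K3 twin `S″`, a generator
`p″` and an ALGEBRAIC `Ψ : H²(S″) ≃ H²(S)` with rational, type-preserving, form-halving inverse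
(verbatim tail of `Theses.NikulinTwinTransport.TwinTwistorTransport`). -/
def AnchorAt (μ : OrientationFamily) (S : SchemeOver ℂ) (hS : K3Block S)
    (p : complexBetti S (2 * 2)) : Prop :=
  ∃ (S'' : Literature.AlgebraicGeometry.Motives.SchemeOver ℂ) (hS'' : (Literature.AlgebraicGeometry.Motives.IsSmoothProjective 2 S'' ∧ Subsingleton (Literature.AlgebraicGeometry.Motives.structureSheafCohomology S''.left 1) ∧ ∃ (A : Literature.AlgebraicGeometry.HodgeTheory.HodgeModel 2 S'') (η : Literature.Geometry.Kaehler.MForm 𝓘(ℝ, A.model) A.carrier ℂ 2), Literature.Geometry.Kaehler.IsHolomorphicInCharts η ∧ ∀ x, η x ≠ 0)) (p'' : Literature.AlgebraicGeometry.HodgeTheory.complexBetti S'' (2 * 2)), (Literature.AlgebraicGeometry.HodgeTheory.IsIntegralClass p'' ∧ ∀ q : Literature.AlgebraicGeometry.HodgeTheory.complexBetti S'' (2 * 2), Literature.AlgebraicGeometry.HodgeTheory.IsIntegralClass q → ∃ n : ℤ, q = n • p'') ∧ ∃ Ψ : Literature.AlgebraicGeometry.HodgeTheory.complexBetti S'' (2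 * 1) ≃ₗ[ℂ] Literature.AlgebraicGeometry.HodgeTheory.complexBetti S (2 * 1), (∀ y, Literature.AlgebraicGeometry.HodgeTheory.IsRationalClass y → Literature.AlgebraicGeometry.HodgeTheory.IsRationalClass (Ψ.symm y)) ∧ (∀ (i j : ℕ) y, Literature.AlgebraicGeometry.HodgeTheory.IsOfHodgeType 2 S (2 * 1) i j y → Literature.AlgebraicGeometry.HodgeTheory.IsOfHodgeType 2 S'' (2 * 1) i j (Ψ.symm y)) ∧ (∀ (u v : Literature.AlgebraicGeometry.HodgeTheory.complexBetti S (2 * 1)) (b : ℂ), Literature.AlgebraicTopology.SingularHomology.cupProduct (rfl : 2 * 1 + 2 * 1 = 2 * 2) u v = ((2 : ℂ) * b) • p → Literature.AlgebraicTopology.SingularHomology.cupProduct (rfl : 2 * 1 + 2 * 1 = 2 * 2) (Ψ.symm u) (Ψ.symm v) = b • p'') ∧ ∃ γ ∈ Literature.AlgebraicGeometry.HodgeTheory.algebraicClasses (CategoryTheory.MonoidalCategoryStruct.tensorObj S S'') 2, ∀ x : Literature.AlgebraicGeometry.HodgeTheory.complexBetti S'' (2 * 1), Ψ x = Literature.AlgebraicGeometry.HodgeTheory.complexGysin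 μ (Literature.AlgebraicGeometry.Motives.IsSmoothProjective.tensor_holds hS.1 hS''.1) hS.1 (CategoryTheory.SemiCartesianMonoidalCategory.fst S S'') (rfl : 2 * 1 + 2 * 2 + 2 * 2 = 2 * 1 + 2 * (2 + 2)) (Literature.AlgebraicTopology.SingularHomology.cupProduct (rfl : 2 * 1 + 2 * 2 = 2 * 1 + 2 * 2) (Literature.AlgebraicGeometry.HodgeTheory.complexBetti.map (CategoryTheory.SemiCartesianMonoidalCategory.snd S S'') (2 * 1) x) γ)

/-- The crux, re-read through `AnchorAt` — definitionally the route decl. -/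
theorem crux_iff :
    Theses.NikulinTwinTransport.TwinTwistorTransport ↔
      ∀ (μ : OrientationFamily), μ.HasPoincareDuality → ∀ (S : SchemeOver ℂ) (hS : K3Block S)
        (p : complexBetti S (2 * 2)), IsGenerator S p → AnchorAt μ S hS p :=
  Iff.rfl

/-- (N) the Nikulin locus: `S` carries a symplectic involution — an automorphism of order two acting
trivially on `H^{2,0}(S)`. (Varesco2023 §2 / VanGeemenSarti2007: there the resolved quotient `Y′` and
the completed similitude `g^* ⊕ (N_j ↦ r_j)` give the anchor; forces `ρ(S) ≥ 9`.) -/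
def HasSymplecticInvolution (S : SchemeOver ℂ) : Prop :=
  ∃ ι : S ≅ S, ι.hom ≠ 𝟙 S ∧ ι.hom ≫ ι.hom = 𝟙 S ∧
    ∀ x : complexBetti S (2 * 1), IsOfHodgeType 2 S (2 * 1) 2 0 x →
      complexBetti.map ι.hom (2 * 1) x = x

/-- (T) the norm-2 locus: `H²(S(ℂ);ℂ)` carries a rational, type-preserving 2-SELF-similitude `f`
(`(fx.fy) = 2(x.y)`).  Contains: RM by `ℚ(√2)` (`f = e ⊕ ν`), CM points whose CM field has an
element of relative norm `2` composed with a rational self-isometry, … ; EXCLUDES every `S` with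
`End_Hdg(T(S)) = ℚ` (on `T` a Hodge self-similitude is `c • id`, `c² = 2`, irrational) and every `S`
of odd transcendental rank (landed `Negative.no_self_twoSimilitude_of_odd`). On (T) the twin is
Hodge-ISOMETRIC to `S`, so modulo Buskin (`HodgeIsometryAlgebraic`) the crux there is exactly
"`f` is algebraic" — for RM-√2 the route's own `RealMultiplicationSqrtTwoAlgebraic` /
`TwinTransportRMPicardTwo`. -/
def HasRationalSelfTwoSimilitude (S : SchemeOver ℂ) (p : complexBetti S (2 * 2)) : Prop :=
  ∃ f : complexBetti S (2 * 1) →ₗ[ℂ] complexBetti S (2 * 1),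
    (∀ x, IsRationalClass x → IsRationalClass (f x)) ∧
    (∀ (i j : ℕ) x, IsOfHodgeType 2 S (2 * 1) i j x → IsOfHodgeType 2 S (2 * 1) i j (f x)) ∧
    ∀ (x y : complexBetti S (2 * 1)) (a : ℂ),
      cupProduct (rfl : 2 * 1 + 2 * 1 = 2 * 2) x y = a • p →
        cupProduct (rfl : 2 * 1 + 2 * 1 = 2 * 2) (f x) (f y) = ((2 : ℂ) * a) • p

/-- The crux restricted to a locus `P`. -/
def CruxOn (P : ∀ S : SchemeOver ℂ, complexBetti S (2 * 2) → Prop) : Prop :=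
  ∀ (μ : OrientationFamily), μ.HasPoincareDuality → ∀ (S : SchemeOver ℂ) (hS : K3Block S)
    (p : complexBetti S (2 * 2)), IsGenerator S p → P S p → AnchorAt μ S hS p

/-- Sub₁ — the crux ON the Nikulin locus (in print: Varesco2023 Thm 2.1 / §2; provable modulo the
route's named K3 facts + composition of correspondences). -/
def SubNikulin : Prop := CruxOn fun S _ => HasSymplecticInvolution S

/-- Sub₂ — the crux ON the norm-2 locus (= algebraicity of the self-similitude, modulo Buskin; CM part
known — the landed CM twin anchor p109741 —, RM-√2 part = items 13679 / 15067, open). -/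
def SubNormTwo : Prop := CruxOn fun S p => HasRationalSelfTwoSimilitude S p

/-- Sub₃ — the crux OFF both loci: contains every K3 with `End_Hdg(T) = ℚ` and no symplectic
involution, i.e. the very general member of every family of projective K3 surfaces (all odd
transcendental ranks included). THIS PIECE IS THE WHOLE CRUX (census §Decomposition). -/
def SubGeneric : Prop :=
  CruxOn fun S p => ¬ HasSymplecticInvolution S ∧ ¬ HasRationalSelfTwoSimilitude S p

/-- GLUE: the three pieces give the crux BY NAME (case split; classical). -/
theorem crux_of_subs :
    SubNikulin → SubNormTwo → SubGeneric → Theses.NikulinTwinTransport.TwinTwistorTransport := by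
  intro hN hT hG μ hμ S hS p hp
  by_cases h1 : HasSymplecticInvolution S
  · exact hN μ hμ S hS p hp h1
  by_cases h2 : HasRationalSelfTwoSimilitude S p
  · exact hT μ hμ S hS p hp h2
  · exact hG μ hμ S hS p hp ⟨h1, h2⟩

/-- Each piece is a RESTRICTION of the crux (so none is stronger than the crux). -/
theorem subs_of_crux (h : Theses.NikulinTwinTransport.TwinTwistorTransport) :
    SubNikulin ∧ SubNormTwo ∧ SubGeneric :=
  ⟨fun μ hμ S hS p hp _ => h μ hμ S hS p hp,
   fun μ hμ S hS p hp _ => h μ hμ S hS p hp,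
   fun μ hμ S hS p hp _ => h μ hμ S hS p hp⟩

end Summit.HodgeConjecture.HodgeConjecture.Cruxes.TwinTwistorTransport.StrategyCensus
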